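import Mathlib
import Literature.MathematicalPhysics.QuantumFieldTheory.Balaban1983to89.B16Cor3Ops
import Literature.MathematicalPhysics.QuantumFieldTheory.Balaban1983to89.B16Improved189

/-!
# `Balaban1983to89.B16Cor3Wilson` — [Balaban1989LargeFieldII] pp. 377–380, 383–384, 387 with [III] (2.19), (2.23),
(2.49): the WEIGHT OF THE NEW-REGION OPERATION `(Σ𝐓″_k(Z_k))` of (1.72) — hypothesis `hZ` of the sibling
`B16Cor3Ops.Repr172.uvIneq_of_repr172` (cell GAPS G-pv06-3 (1)) — RE-TYPED AS PRINTED: the small factors of the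
un-renormalized components of `Z_k` come from the WILSON ACTION inside `exp A′_k` UNDER the operation, not from the
operation applied to `1`; kernel-checked: the pull-out (localization) calculus of positive operations, the product of
the per-component Boltzmann weights, the Wilson split of `exp A′_k`, the per-term majorant, and (2.50)/(0.1) one run one
step with `(hZ, hA′up)` replaced by the printed structure

CITATION HEADER (lean-in-tree rule 2026-08-18).  Source: T. Bałaban, *Large field renormalization. II. Localization,
exponentiation, and bounds for the 𝐑 operation*, Commun. Math. Phys. **122**, 355–392 (1989), doi:10.1007/bf01238433
(cell paper B16 = [V]; held: `paper:balaban1989-cmp122-large-field-ii`; journal page = PDF page + 354; every quotation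
below is read from the page renders `HOME/b2b-balaban-ref1/pages/1989-cmp122-large-field-II/…-p023…p026, p029, p030,
p033-x2.png`), with [IV] = T. Bałaban, *Large field renormalization. I. The basic step of the 𝐑 operation*, Commun.
Math. Phys. **122**, 175–202 (1989) [Balaban1989LargeFieldI] pp. 200–201 (renders `…/1989-cmp122-large-field-I/…-p026,
p027-x2.png`, journal page = PDF page + 174) and [III] = T. Bałaban, *Convergent renormalization expansions for lattice
gauge theories*, Commun. Math. Phys. **119**, 243–285 (1988) [Balaban1988Convergent] p. 258 (2.19)–(2.23), p. 264
(2.49)–(2.50), (3.1), and — §4, v2 — pp. 256–257 (2.10)–(2.16) (renders `…/1988-cmp119-convergent-renormalization/…-p014,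
p015, p016, p022-x2.png`, journal page = PDF page + 242).  Fifth module of the surge-node lineage `B14Cor3` (gen 1: (2.50) ⇐ five named leaves H, U1, U2, L1, L2) →
`B16Cor3` (gen 2) → `B16Cor3Scales` (gen 3) → `B16Cor3Ops` (gen 4: U1, L1 proved from (1.72)/(1.73) over four factor
leaves `hZ`, `hY`, `hA′up`, `hcurly`) → here (gen 5: the factor leaf `hZ` together with `hA′up` re-typed and decomposed as
the print describes the mechanism).  No sibling module is modified; `B16Improved189` (unit adv3) is composed BY NAME.

(a) THE PRINTED TEXT.  [III] p. 258 [16]: *"The last large field region is Z_k, and 𝐓_k is supported in it, in the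
sense that it involves integrations and variables restricted to this region. If Z_k is represented as a union of
disjoint regions, e.g. as a union of connected components, Z_k = X_1 ∪ … ∪ X_n, X_i ∩ X_j = ∅ for i ≠ j, then 𝐓_k(Z_k)
= Π_{i=1}^{n} 𝐓_k(X_i). (2.19) The operations corresponding to disjoint regions commute, i.e., 𝐓_k(X_i)𝐓_k(X_j) =
𝐓_k(X_j)𝐓_k(X_i)."*; *"The operation 𝐓^{(j)} involves integration with respect to the gauge field variables V_j on
Ω^c_{j+1} ∩ X, and with respect to the fluctuation field variables A_j on Z_{j+1} ∩ Ω_{j+1} ∩ X"*; *"The action A_k is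
determined by the three sequences of sets, and it depends on the gauge field variable V, given by (2.10), through the
background field U_k(V)."*; *"A_k(1/g_k², U_k) = −A(1/g_k², U_k) + 𝐄_k(U_k) + 𝐑_k(U_k) + 𝐁_k(U_k, A) − E_k. (2.23)"*.
[III] p. 264 [22]: *"A_k(1/g_k², U_k) = −A(1/g_k², U_k) + (the logarithmic terms) + O(1) Σ_{j=1}^{k} |Γ_j|. (2.49)
The first term on the right-hand side yields the small factors for large field characteristic functions. It also
controls the logarithmic terms. Thus we estimate the integral ∫dV_kρ_k by a sum of terms similar to the one considered
in Sect. 3 [6], e.g., see (3.42)."*; *"(Tρ_k)(V_{k+1}) = Σ_{{Ω_j},{Λ_j}} ∫dV_k δ(V̄_kV_{k+1}⁻¹)χ_k𝐓_k exp A_k, (3.1)"*.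
[IV] p. 200 [26]: *"The components of the regions are divided into two classes: the components satisfying the
conditions (i), (ii), for which the corresponding integral operations are given by the integrals in (1.76), and the
remaining components, for which the integral operations have many forms, varying from the old 𝐓-operations to the
integrals as in (1.76), but with some large field characteristic functions, through the intermediate operations
described above. These operations are denoted by 𝐓″_k."* ((1.99): `… χ_{k,Λ}𝐓″_k(Z_k∖Z)∫dV_h⌈… · ∫dV′⌈_{B₀}δ_{T₀}(V′)χ′
exp A″_k` — the action is to the RIGHT of `𝐓″_k`); p. 201 [27]: *"The operation 𝐓″_k above includes a summation over
all possible forms of this operation in various components of Z_k∖Z. Now we rearrange the sum above. We denote Z_k∖Z by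
Z_k, … and we separate the summation over the admissible Z_k, n, X_1,…,X_n from the remaining summations, which are
factorized in those domains. … The integrations in (1.99) are also factorized in those components."*  [V] p. 377 [23]:
*"Denote this action by A′_k. The result of all the preceding operations can be written as the equality: (1.1) =
χ_kχ_{k,Λ}δ_{G₀}(V′_k)χ exp A′_k(1/(g_k(·))², U_k) · χ_{h,1/2}∫dB σ(g_kB)δ_{T₀}(B)χ′ exp[−½⟨DH″_{1,k,Z}B, ζDH″_{1,k,Z}B⟩
− A((g″_k(·))⁻²ζ₁, U″_{h+2}(exp ig_kB, V″)) + Σ_Y V(Y,U_k,B) + E_k(Z) + (−½d(𝐠)log g_k⁻² + log σ₀)|𝐁₀∖T₀| − E_k(Λ)],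
(1.70)"*; p. 378 [24]: *"To write its final form, we introduce a new 𝐓-operation. It is defined for a component of Z by
a composition of the integration in (1.70) localized in this component, and the integration together with the
𝐓_h-operation in (1.100) [IV], also localized in this component. We use the fact that these integrations factorize in
components of Z."*; p. 379 [25], (1.72): *"(𝐑ρ_k)(V_k) = Σ_{Z_k} Σ_{{Y_1,…,Y_m}} χ_k(⋯) · (Σ_{{Ω^c_j,Z_j}} 𝐓″_k(Z_k))
exp A′_k(1/(g_k(·))², U_k) · Π_{i=1}^{m} χ^c_k(Y_i^{~−6})χ_{k,Λ_i}χ_iδ_{G_i}(V′_k)𝐓′_k(Y_i) · {⋯}"*; p. 380 [26]: *"From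
the inequality (1.73) it is clear that we have to find a bound of 𝐓′_k(X,(U,0))1, which we denote for simplicity by
𝐓′_k(X)1. At first we bound all the expressions in the exponential, except the Wilson action and the quadratic forms.
… Next, we bound the Wilson action and the quadratic forms, or rather the corresponding Gaussian integrals. We have to
obtain all small factors connected with large fields. Here the situation is almost exactly the same as in [16], so we
summarize the results, and we discuss only some new issues. Consider large field characteristic functions introduced
in the j^{th} step. There is the function χ^c_j(P_j), which yields the factor exp(−γ₀(1/(2g_j²))(B₃⁻¹ε_j)²(LM₂R_j)^{−d}
|P_j|) in the usual way, using Theorem 1 [15] and (71) [16]."*; pp. 383–384 [29–30], after (1.79): *"Notice that the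
above inequality holds for all large field regions, not only for the regions satisfying the conditions (i), (ii). For
the last regions we will prove that the expression on the right-hand side can be estimated by exp(−2p₀(g_k)). For
general regions we will prove the inductive statement below. … If Z is a component of Z_j, and j(Z) is the index of a
first large field region contained in Z, then we write the factor connected with Z in the form exp(−κ_j(Z) −
2p₀(g_{j(Z)}))."*; p. 383 [29]: *"Finally, the summations over the admissible sequences can be replaced by the factors
exp O(1)(MR_j)^{−d}|Z_j|."*; p. 387 [33]: *"Next, we have noticed already that the inequality (1.79) holds for the
𝐓-operation connected with an arbitrary large field region. The inequality (1.80) holds quite generally for such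
regions, hence also an improved bound (1.89), with the additional term −κ₁d_k(X) in the exponential. This implies the
inequality (2.50) [III], hence Corollary 3."*

(b) THE TYPED READING.  Gen 4 majorised a summand of (1.72) with the factor leaves `TZ_a 1 ≤ Π_{X∈Z_k} w(X)` (`hZ`) and
`A′_k ≤ E′N` (`hA′up`).  For the components `Y_i` (renormalized NOW: their localized Wilson action `−A((g″_k(·))⁻²ζ₁Γ_X,
U″_{h+2})` sits INSIDE `𝐓′_k` by (1.71)) the weight `𝐓′_k(Y)1` is what (1.79)/(1.89) literally bound; for the components
of the new region `Z_k` (= `Z_k∖Z` of [IV] p. 201: NOT renormalized at this step) the operation `𝐓″_k` is a composite of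
OLD one-step operations (2.21) [III] and its Wilson action stays in `exp A′_k(1/(g_k(·))², U_k)` to its RIGHT ((1.72),
(1.99) [IV]; (3.1) [III] `𝐓_k exp A_k`), depending on the integrated variables through `U_k(V)` ([III] p. 258) — and the
print says where the small factors come from: *"The first term on the right-hand side [of (2.49), −A(1/g_k²,U_k)]
yields the small factors"* ([III] p. 264), *"we bound the Wilson action and the quadratic forms, or rather the
corresponding Gaussian integrals. We have to obtain all small factors connected with large fields"* ([V] p. 380).  So
`hZ` — smallness of `(Σ𝐓″_k(Z_k))1` — is the printed mechanism only if the operation is read as INCLUDING the Boltzmann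
factor of its region (cell DIVERGENCE D-pv06.5).  This module types the mechanism as printed and proves the bookkeeping:
§1 the PULL-OUT LAW `Pull T H : T(F·H) = (TF)·H` (the typed content of (2.19) [III] *"supported in it, in the sense that
it involves integrations and variables restricted to this region"* and [V] p. 378 *"these integrations factorize in
components of Z"*: a function of variables the operation does not integrate is a constant for it), its closure under
every construction of the operations (products `pull_mul`, composition `pull_comp`, history sums `pull_sumOp`,
multipliers `pull_mulOp`, composites `pull_pi`; the kernel model `pull_ofKernel`: a function not depending on the
integrated variables is pulled out — the law is not vacuous), `|TF| ≤ T G` for `|F| ≤ G` (`abs_apply_le_apply`), and the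
PRODUCT THEOREM `pi_mul_le` / `pi_prod_le`: if each component operation `T_X` weighs ITS OWN Boltzmann factor by
`T_X[B_X] ≤ w(X)` uniformly and pulls out the factors of the OTHER components, then `(T_{X₁}∘⋯∘T_{X_n})[Π_X B_X] ≤
Π_X w(X)` — the multiplicative form of gen 4's `PosOp.pi_one_le`, which is its case `B ≡ 1`; §2 the WILSON SPLIT
`exp_split_of_wilson`: if `A′_k = rest − Σ_{p} e_p` with NON-NEGATIVE plaquette terms `e_p` (the Wilson action
`A(1/(g_k(·))², U_k) = Σ_p g_k(p)⁻²(1 − Re tr U_k(∂p))`-type sum, (2.23)/(1.70)), the plaquette families `plaq(X) ⊆ P`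
attributed to the components are pairwise disjoint, and `rest ≤ E′N` (the upper (2.49) bookkeeping of the OTHER terms,
cell GAPS G-adv3-2), then `exp A′_k ≤ e^{E′N} · Π_{X∈Z_k} exp(−Σ_{p∈plaq X} e_p)` pointwise (partial sums of a
non-negative family; `Finset.sum_biUnion`); §3 at the level of gen 4's term data `Repr172`: the per-term majorant
`abs_term_le_boltzmann` (`|term_a| ≤ e^{BA}·Bc·(wZ·wY)` — the SAME conclusion as gen 4's `abs_term_le` — from `exp A′_k ≤
e^{BA}·Bz`, `TZ_a[Bz] ≤ wZ`, `TYs_a 1 ≤ wY`, `|curly| ≤ Bc`, by (1.73) in the form `|T F| ≤ T G`), the discharge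
`tz_boltzmann_le_of_factors` of `TZ_a[Π_X B_X] ≤ Π_X w(X)` from the component structure (`TZ_a = T_{X₁}∘⋯∘T_{X_n}` over an
enumeration of the components, [IV] p. 201 / (2.19) [III]; pull-out across components; per-component leaf), the link
`hw_of_improved189` (the per-component leaf in the improved-(1.89) shape `exp(−(1+β₀)⁻¹p₀(g_k) − κ₁d_k(X))` IS what
`B16Improved189.improved189_of_fundIneq` delivers for the weight function `V ↦ T_X[B_X](V)` from `Step.FundIneq189` and
the size trade — composed by name), and `uvIneq_of_repr172_wilson` = gen 4's `uvIneq_of_repr172` with `(hZ, hA′up)`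
REPLACED by (component structure `hTZ`, pull-out `hpull`, per-component leaf `hw : T_X[B_X] ≤ exp(−c₀ − κ₁d_k(X))`, split
`hsplit : exp A′_k ≤ e^{E′N}Π_{X∈Z_k}B_X`), every other hypothesis and the conclusion `B16.UVIneq … (E₁+ε) (E′ + ε′ +
πc·K₀(c₀,Δ)·Σ_{i<2}e^{−c_i})` verbatim as there (the assembly is `B16Cor3Scales.uvIneq_of_structure_classes`, as in gen 4); §4 (v2, append-only)
WHERE THE PULL-OUT LAW COMES FROM: in the kernel model `hpull` is exactly a DISJOINTNESS statement — the factor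
depends only on the variables of a determining set (Mathlib `DependsOn`; the localized minimal configurations
`U_{k,□}(V_k) = U(𝐁_k(□^{~4}), ·)` of (2.14)–(2.16) [III]), the operation modifies only the variables of its integration
set ([III] p. 258), and the two are disjoint (`pull_ofKernel_of_dependsOn`, `dependsOn_boltzmann`, `hpull_of_disjoint`);
and it FAILS without disjointness already for one variable (`pull_fails_without_disjointness`) — the un-localized
global minimizer `U_k(V)` of (2.12) [III] is not pulled out, which is the content of cell GAPS G-pv06-4.

WHAT IS *NOT* REPRODUCED OR ASSERTED: (1.79), (1.80), (1.89), (2.49), Theorem 1 [15], (71) [16] themselves; the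
per-component leaf `T_X[B_X] ≤ w(X)` is a HYPOTHESIS with the locators above ((1.79) *"holds for all large field
regions"* pp. 383–384, p. 387 *"the 𝐓-operation connected with an arbitrary large field region … an improved bound
(1.89)"*, the history count of p. 383 absorbed as in gen 4's `count_absorb`, [III] p. 264's sentence for WHERE the factor
comes from); the pull-out law across components is a HYPOTHESIS (`hpull`) whose printed support is (2.19) [III] + [V]
p. 378 + [IV] p. 201 *"factorized in those components"* — that the Wilson terms attributed to a component `X′` are
functions of variables the operation of `X ≠ X′` does not integrate is a LOCALIZATION statement about the background
field `U_k(V)` ((2.41)(i) [III], (1.60)–(1.63) [IV]) which the print does not display for `A′_k` (cell GAPS G-pv06-4,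
located objection, LOW); whether (1.70)/(1.72) write the Wilson terms `−A⌈_{Z_k}` with fields localized as in (2.14)–(2.16) [III], and where
the localization error goes, is NOT decided here (G-pv06-4: §4 types the sufficient condition, it does not assert it);
the attribution of pairwise disjoint plaquette families to the components is the DATUM `plaq` with `hdisj` — print
gives the disjointness of the components themselves ([IV] p. 177: *"where Z = ∪_{i=1}^m X_i is the decomposition into
disjoint components"*), not a displayed attribution of plaquettes (v3 DOCFIX, cell GAPS C-ref5-42 V1: v1/v2 cited here
(1.76) [IV] / p. 384 operation `S`, which state no such separation); the sum–product exchange of the history sums over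
components is inside the reading of `T_X` ([IV] p. 201: the summation over the forms of the operation is per
component).  Instantiated with trivial data the theorems restate their hypotheses — the content is the kernel-checked
bookkeeping from the printed MECHANISM (Wilson action under the operation, factorization over components) to the
per-term majorant gen 1–4 consume, with each leaf located.  NOTHING of the series is asserted; value = typed skeleton +
located leaves + kernel bookkeeping, NOT summit progress.  Unit `b2b-balaban-pv06-g5` (surge node prover #06, gen 5);
companion rows: cell `GAPS.md` C-pv06-5 (this certification, v1 p179202), C-pv06-6 (§4, v2), G-pv06-4 (the
localization residual), G-pv06-3, C-pv06-4, G-adv3-2, G-adv3-6, C-B16-9, C-ref5-42 (cross-read, ref5-g4);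
`DIVERGENCE.md` D-pv06.5.  v2 = v1 + §4 and these header sentences; no v1 declaration changed.  v3 = DOCSTRING-ONLY fix of
the cross-read's objection V1 (the v1/v2 docstrings attributed a separation of distinct components of Z_k to [III] p. 256
and to (1.76)/p. 384 [V]; print gives only the disjointness of the components, [IV] p. 177 (1.1), render
`…/1989-cmp122-large-field-I/…-p003-x2.png`; the separations used are DATA `hdisj`/`hsep`) + one elision marker; no
declaration, signature or proof changed.
-/

namespace Literature.MathematicalPhysics.QuantumFieldTheory.Balaban1983to89.B16Cor3Wilson

open Literature.MathematicalPhysics.QuantumFieldTheory.Balaban1983to89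
open B16Cor3Ops

/-! ## 1. Positive operations: `|TF| ≤ TG`, the pull-out (localization) law, and the product of Boltzmann weights -/

section PosOpCalculus

variable {C : Type*}

/-- `T(−F) = −TF` (homogeneity with `c = −1`). [folklore] -/
theorem neg_apply (P : PosOp C) (F : C → ℝ) (x : C) : P.T (fun y => -F y) x = -P.T F x := by
  have h := P.smul (-1) F x
  have e : (fun y => (-1 : ℝ) * F y) = fun y => -F y := funext fun y => by ring
  rw [e] at h
  simpa using h

/-- **(1.73) in the form `|TF| ≤ T G` for `|F| ≤ G` pointwise** (p. 380 *"≤ 𝐓′_k(X,(U,0))|e^σF|"*: a positive operation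
is monotone, applied to `F ≤ G` and `−F ≤ G`). [cite: Balaban1989LargeFieldII, (1.73) p.380] -/
theorem abs_apply_le_apply (P : PosOp C) {F G : C → ℝ} (h : ∀ y, |F y| ≤ G y) (x : C) :
    |P.T F x| ≤ P.T G x := by
  rw [abs_le]
  refine ⟨?_, P.mono F G (fun y => (le_abs_self _).trans (h y)) x⟩
  have h1 : P.T (fun y => -F y) x ≤ P.T G x := P.mono _ G (fun y => (neg_le_abs _).trans (h y)) x
  rw [neg_apply] at h1
  linarith

/-- THE PULL-OUT (LOCALIZATION) LAW: the function `H` is a constant for the operation `T` — `T(F·H) = (TF)·H` for every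
`F`.  Typed content of [III] p. 258 *"𝐓_k is supported in it, in the sense that it involves integrations and variables
restricted to this region"* and [V] p. 378 *"We use the fact that these integrations factorize in components of Z"*: a
function of variables that the operation of a component does not integrate passes through it. [cite: Balaban1988Convergent, (2.19) p.258] -/
def Pull (P : PosOp C) (H : C → ℝ) : Prop :=
  ∀ (F : C → ℝ) (x : C), P.T (fun y => F y * H y) x = P.T F x * H x

/-- Constants are pulled out of every positive operation (homogeneity). [folklore] -/
theorem pull_const (P : PosOp C) (c : ℝ) : Pull P (fun _ => c) := by
  intro F x
  have e : (fun y => F y * (fun _ : C => c) y) = fun y => c * F y := funext fun y => by simp [mul_comm]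
  rw [e, P.smul, mul_comm]

/-- Pulled-out functions are closed under products: `T(F·H₁H₂) = T(F·H₁)·H₂ = (TF)·H₁·H₂`. [folklore] -/
theorem pull_mul (P : PosOp C) {H₁ H₂ : C → ℝ} (h₁ : Pull P H₁) (h₂ : Pull P H₂) :
    Pull P (fun y => H₁ y * H₂ y) := by
  intro F x
  have e : (fun y => F y * (H₁ y * H₂ y)) = fun y => (F y * H₁ y) * H₂ y := funext fun y => by ring
  rw [e, h₂ (fun y => F y * H₁ y) x, h₁ F x, mul_assoc]

/-- … and under finite products over a list. [folklore] -/
theorem pull_list_prod (P : PosOp C) {ι : Type*} (H : ι → C → ℝ) :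
    ∀ l : List ι, (∀ i ∈ l, Pull P (H i)) → Pull P (fun y => (l.map fun i => H i y).prod)
  | [], _ => by simpa using pull_const P 1
  | i :: l, h => by
      have e : (fun y => ((i :: l).map fun j => H j y).prod) = fun y => H i y * (l.map fun j => H j y).prod :=
        funext fun y => by simp
      rw [e]
      exact pull_mul P (h i List.mem_cons_self) (pull_list_prod P H l fun j hj => h j (List.mem_cons_of_mem i hj))

/-- The identity operation pulls out everything. [folklore] -/
theorem pull_idOp (H : C → ℝ) : Pull (PosOp.idOp : PosOp C) H := fun _ _ => rfl

/-- A multiplier (characteristic function) pulls out everything. [folklore] -/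
theorem pull_mulOp (m : C → ℝ) (hm : ∀ x, 0 ≤ m x) (H : C → ℝ) : Pull (PosOp.mulOp m hm) H := by
  intro F x
  show m x * (F x * H x) = m x * F x * H x
  ring

/-- Composition preserves the law: if `H` is a constant for `P` and for `Q` it is one for `P∘Q` ((2.20) [III]: the
operation of a region is a composite of one-step operations, each supported in the region). [cite: Balaban1988Convergent, (2.20) p.258] -/
theorem pull_comp {P Q : PosOp C} {H : C → ℝ} (hP : Pull P H) (hQ : Pull Q H) : Pull (P.comp Q) H := by
  intro F x
  show P.T (Q.T (fun y => F y * H y)) x = P.T (Q.T F) x * H x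
  have e : Q.T (fun y => F y * H y) = fun y => Q.T F y * H y := funext fun y => hQ F y
  rw [e, hP]

/-- A finite sum of operations (the history sum `Σ_{{Ω^c_j, Z_j}}` inside a component, [IV] p. 201 *"includes a
summation over all possible forms of this operation in various components"*) preserves the law. [cite: Balaban1989LargeFieldI, p.201 after (1.99)] -/
theorem pull_sumOp {Hh : Type*} (S : Finset Hh) (ops : Hh → PosOp C) {H : C → ℝ}
    (h : ∀ i ∈ S, Pull (ops i) H) : Pull (PosOp.sumOp S ops) H := by
  intro F x
  show ∑ i ∈ S, (ops i).T (fun y => F y * H y) x = (∑ i ∈ S, (ops i).T F x) * H x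
  rw [Finset.sum_mul]
  exact Finset.sum_congr rfl fun i hi => h i hi F x

/-- A composite over a list of operations preserves the law. [folklore] -/
theorem pull_pi {δ : Type*} (ops : δ → PosOp C) {H : C → ℝ} :
    ∀ l : List δ, (∀ d ∈ l, Pull (ops d) H) → Pull (PosOp.pi ops l) H
  | [], _ => pull_idOp H
  | d :: l, h => pull_comp (h d List.mem_cons_self) (pull_pi ops l fun d' hd' => h d' (List.mem_cons_of_mem d hd'))

/-- NON-VACUITY of the law in the kernel model of gen 4 (`PosOp.ofKernel`: `(TF)(x) = Σ_ω K(x,ω)F(φ_ω(x))`, `φ_ω(x)` =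
the configuration with the integrated variables set to `ω`): a function that does not depend on the integrated
variables (`H(φ_ω x) = H x`) is pulled out — Fubini for a finite positive kernel. [folklore] -/
theorem pull_ofKernel {Ω : Type*} (S : Finset Ω) (K : C → Ω → ℝ) (φ : Ω → C → C) (hK : ∀ x ω, 0 ≤ K x ω)
    {H : C → ℝ} (hH : ∀ x, ∀ ω ∈ S, H (φ ω x) = H x) : Pull (PosOp.ofKernel S K φ hK) H := by
  intro F x
  show ∑ ω ∈ S, K x ω * (F (φ ω x) * H (φ ω x)) = (∑ ω ∈ S, K x ω * F (φ ω x)) * H x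
  rw [Finset.sum_mul]
  exact Finset.sum_congr rfl fun ω hω => by rw [hH x ω hω]; ring

/-- **THE PRODUCT OF BOLTZMANN WEIGHTS** — the multiplicative form of gen 4's `PosOp.pi_one_le` (its case `B ≡ 1`):
operations `T_d` (d ∈ l, no repetition) each weighing ITS OWN non-negative factor by `T_d[B_d] ≤ w_d` uniformly in the
configuration, and each pulling out the factors of the OTHER indices and the spectator `H ≥ 0`, satisfy
`(T_{d₁}∘⋯∘T_{d_n})[Π_i B_{d_i} · H] ≤ (Π_i w_{d_i}) · H` pointwise.  Induction on the list: the innermost operations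
leave `B_{d₁}·H` untouched (pull-out), their result is bounded by the constant `Π_{i≥2} w_{d_i}` (induction hypothesis
with spectator `B_{d₁}·H`), then `T_{d₁}` weighs `B_{d₁}` and pulls out `H` — the typed form of *"these integrations
factorize in components of Z"* (p. 378) combined with (1.73). [cite: Balaban1989LargeFieldII, p.378 before (1.71) and (1.73) p.380] -/
theorem pi_mul_le {δ : Type*} (ops : δ → PosOp C) (B : δ → C → ℝ) (w : δ → ℝ) :
    ∀ l : List δ, l.Nodup →
      (∀ d ∈ l, ∀ y, 0 ≤ B d y) →
      (∀ d ∈ l, ∀ y, (ops d).T (B d) y ≤ w d) →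
      (∀ d ∈ l, ∀ d' ∈ l, d ≠ d' → Pull (ops d) (B d')) →
      ∀ H : C → ℝ, (∀ y, 0 ≤ H y) → (∀ d ∈ l, Pull (ops d) H) →
      ∀ x, (PosOp.pi ops l).T (fun y => (l.map fun d => B d y).prod * H y) x ≤ (l.map w).prod * H x
  | [], _, _, _, _, H, _, _, x => by
      show (fun y => (([] : List δ).map fun d => B d y).prod * H y) x ≤ (([] : List δ).map w).prod * H x
      simp
  | d :: l, hnd, hB, hw, hpull, H, hH, hHp, x => by
      obtain ⟨hdl, hl⟩ := List.nodup_cons.mp hnd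
      have hdm : d ∈ d :: l := List.mem_cons_self
      have hsub : ∀ d' ∈ l, d' ∈ d :: l := fun d' hd' => List.mem_cons_of_mem d hd'
      -- the spectator for the inner composite: `B_d · H`
      have hH' : ∀ y, 0 ≤ B d y * H y := fun y => mul_nonneg (hB d hdm y) (hH y)
      have hHp' : ∀ d' ∈ l, Pull (ops d') (fun y => B d y * H y) := fun d' hd' =>
        pull_mul (ops d') (hpull d' (hsub d' hd') d hdm (ne_of_mem_of_not_mem hd' hdl)) (hHp d' (hsub d' hd'))
      have ih := pi_mul_le ops B w l hl (fun d' hd' => hB d' (hsub d' hd')) (fun d' hd' => hw d' (hsub d' hd'))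
        (fun d₁ h₁ d₂ h₂ hne => hpull d₁ (hsub d₁ h₁) d₂ (hsub d₂ h₂) hne) (fun y => B d y * H y) hH' hHp'
      have hwnn : ∀ d' ∈ d :: l, 0 ≤ w d' := fun d' hd' =>
        ((ops d').apply_nonneg (hB d' hd') x).trans (hw d' hd' x)
      have hprod : 0 ≤ (l.map w).prod :=
        List.prod_nonneg fun a ha => by
          obtain ⟨d', hd', rfl⟩ := List.mem_map.mp ha
          exact hwnn d' (hsub d' hd')
      have e : (fun y => ((d :: l).map fun d' => B d' y).prod * H y)
          = fun y => (l.map fun d' => B d' y).prod * (B d y * H y) := by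
        funext y
        simp only [List.map_cons, List.prod_cons]
        ring
      show (ops d).T ((PosOp.pi ops l).T (fun y => ((d :: l).map fun d' => B d' y).prod * H y)) x
        ≤ ((d :: l).map w).prod * H x
      rw [e, List.map_cons, List.prod_cons]
      calc (ops d).T ((PosOp.pi ops l).T fun y => (l.map fun d' => B d' y).prod * (B d y * H y)) x
          ≤ (ops d).T (fun y => (l.map w).prod * (B d y * H y)) x := (ops d).mono _ _ (fun y => ih y) x
        _ = (l.map w).prod * (ops d).T (fun y => B d y * H y) x := (ops d).smul _ _ x
        _ = (l.map w).prod * ((ops d).T (B d) x * H x) := by rw [hHp d hdm (B d) x]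
        _ ≤ (l.map w).prod * (w d * H x) :=
            mul_le_mul_of_nonneg_left (mul_le_mul_of_nonneg_right (hw d hdm x) (hH x)) hprod
        _ = w d * (l.map w).prod * H x := by ring

/-- The same without spectator and with the products written over the finite FAMILY enumerated by `l`:
`(T_{X₁}∘⋯∘T_{X_n})[Π_{X} B_X] ≤ Π_{X} w(X)`. [cite: Balaban1989LargeFieldII, p.378 before (1.71) and (1.73) p.380] -/
theorem pi_prod_le {δ : Type*} [DecidableEq δ] (ops : δ → PosOp C) (B : δ → C → ℝ) (w : δ → ℝ)
    {l : List δ} (hl : l.Nodup) (hB : ∀ d ∈ l, ∀ y, 0 ≤ B d y)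
    (hw : ∀ d ∈ l, ∀ y, (ops d).T (B d) y ≤ w d)
    (hpull : ∀ d ∈ l, ∀ d' ∈ l, d ≠ d' → Pull (ops d) (B d')) (x : C) :
    (PosOp.pi ops l).T (fun y => ∏ d ∈ l.toFinset, B d y) x ≤ ∏ d ∈ l.toFinset, w d := by
  have h := pi_mul_le ops B w l hl hB hw hpull (fun _ => 1) (fun _ => zero_le_one)
    (fun d _ => pull_const (ops d) 1) x
  have e : (fun y => ∏ d ∈ l.toFinset, B d y) = fun y => (l.map fun d => B d y).prod * (fun _ : C => (1 : ℝ)) y := by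
    funext y
    rw [List.prod_toFinset _ hl]
    simp
  rw [e, List.prod_toFinset w hl]
  simpa using h

end PosOpCalculus

/-! ## 2. The Wilson split of `exp A′_k` ((2.23)/(2.49) [III], (1.70) [V], [III] p. 264 "the first term … yields the
small factors") -/

/-- **THE WILSON SPLIT.**  `A′_k = rest − Σ_{p∈P} e_p` with `e_p ≥ 0` — the Wilson action `A(1/(g_k(·))², U_k)` of
(1.70)/(1.72) ((2.23) [III]) is a sum of NON-NEGATIVE plaquette terms with non-negative space-dependent coefficients —
and `rest ≤ BA` (the upper (2.49) [III] bookkeeping of the 𝐄-, 𝐑-, 𝐁-terms, counterterms and normalization constants: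
`BA = E′|T|`, cell GAPS G-adv3-2); the plaquette families `plaq(X) ⊆ P` attributed to the components `X ∈ Z_k` are
pairwise disjoint — a DATUM `hdisj` (print: the components of `Z` are disjoint, [IV] p. 177 *"the decomposition into
disjoint components"*; which plaquettes are attributed to which component is not displayed in print; v3 DOCFIX C-ref5-42 V1).
Then, dropping the Wilson terms away
from `Z_k` by non-negativity, `exp A′_k ≤ e^{BA} · Π_{X∈Z_k} exp(−Σ_{p∈plaq X} e_p)` pointwise — [III] p. 264 *"The first
term on the right-hand side yields the small factors for large field characteristic functions"* as bookkeeping: the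
Boltzmann factor of each component is made available UNDER the operation. [cite: Balaban1988Convergent, (2.49) p.264] -/
theorem exp_split_of_wilson {Cfg Dom Pl : Type*} [DecidableEq Pl] (A' rest : Cfg → ℝ) (P : Finset Pl)
    (e : Pl → Cfg → ℝ) (he : ∀ p ∈ P, ∀ V, 0 ≤ e p V) (hA : ∀ V, A' V = rest V - ∑ p ∈ P, e p V)
    (Zc : Finset Dom) (plaq : Dom → Finset Pl) (hsub : ∀ X ∈ Zc, plaq X ⊆ P)
    (hdisj : (Zc : Set Dom).PairwiseDisjoint plaq) {BA : ℝ} (hrest : ∀ V, rest V ≤ BA) (V : Cfg) :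
    Real.exp (A' V) ≤ Real.exp BA * ∏ X ∈ Zc, Real.exp (-(∑ p ∈ plaq X, e p V)) := by
  have hle : ∑ X ∈ Zc, ∑ p ∈ plaq X, e p V ≤ ∑ p ∈ P, e p V := by
    rw [← Finset.sum_biUnion hdisj]
    exact Finset.sum_le_sum_of_subset_of_nonneg (Finset.biUnion_subset.mpr hsub) fun p hp _ => he p hp V
  rw [← Real.exp_sum, ← Real.exp_add]
  apply Real.exp_le_exp.mpr
  rw [hA V, Finset.sum_neg_distrib]
  linarith [hrest V]

/-! ## 3. (1.72): the per-term majorant from the Boltzmann weight of `Z_k`, and (2.50)/(0.1) with `(hZ, hA′up)` replaced -/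

section Terms

variable {Cfg : Type*} {Dom : Type*}

/-- **Leaf U1, per term, Wilson form** — the majorisation of a summand of (1.72) with the SAME conclusion as gen 4's
`Repr172.abs_term_le`, `|term_a| ≤ e^{BA}·Bc·(wZ·wY)`, but from the printed mechanism for the new region: the exponential
splits as `exp A′_k ≤ e^{BA}·Bz` with a non-negative Boltzmann factor `Bz` of `Z_k` (§2), the `Z_k`-operation weighs it,
`TZ_a[Bz] ≤ wZ` ((1.79)/(1.89)-improved *"for the 𝐓-operation connected with an arbitrary large field region"*, p. 387,
with [III] p. 264 for where the factor comes from), `TYs_a 1 ≤ wY` ((1.89) per `Y_i`, composed), `|curly_a| ≤ Bc`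
((1.98)–(1.100)), `0 ≤ χ_a ≤ 1`; (1.73) is used as `|T F| ≤ T G` (`abs_apply_le_apply`) and homogeneity. [cite: Balaban1989LargeFieldII, (1.73) p.380 and p.387 after (1.89)] -/
theorem abs_term_le_boltzmann (R : Repr172 Cfg Dom) (a : R.Adm) {wZ wY BA Bc : ℝ} (Bz : Cfg → ℝ)
    (hχ : ∀ V, 0 ≤ R.χ a V ∧ R.χ a V ≤ 1)
    (hBz : ∀ V, 0 ≤ Bz V) (hsplit : ∀ V, Real.exp (R.A' V) ≤ Real.exp BA * Bz V)
    (hZB : ∀ V, (R.TZ a).T Bz V ≤ wZ) (hY : ∀ V, (R.TYs a).T 1 V ≤ wY)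
    (hc : ∀ V, |R.curly a V| ≤ Bc) (V : Cfg) :
    |R.term a V| ≤ Real.exp BA * Bc * (wZ * wY) := by
  have hBc : 0 ≤ Bc := (abs_nonneg _).trans (hc V)
  have hwY : 0 ≤ wY := ((R.TYs a).one_nonneg V).trans (hY V)
  have h1 : ∀ V', |(R.TYs a).T (R.curly a) V'| ≤ Bc * wY := fun V' =>
    ((R.TYs a).abs_apply_le hc V').trans (mul_le_mul_of_nonneg_left (hY V') hBc)
  set K : ℝ := Real.exp BA * (Bc * wY) with hKdef
  have hK : 0 ≤ K := mul_nonneg (Real.exp_pos _).le (mul_nonneg hBc hwY)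
  have h2 : ∀ V', |R.inner a V'| ≤ (fun V'' => K * Bz V'') V' := fun V' => by
    show |Real.exp (R.A' V') * (R.TYs a).T (R.curly a) V'| ≤ K * Bz V'
    rw [abs_mul, abs_of_pos (Real.exp_pos _)]
    calc Real.exp (R.A' V') * |(R.TYs a).T (R.curly a) V'|
        ≤ (Real.exp BA * Bz V') * (Bc * wY) :=
          mul_le_mul (hsplit V') (h1 V') (abs_nonneg _) (mul_nonneg (Real.exp_pos _).le (hBz V'))
      _ = K * Bz V' := by rw [hKdef]; ring
  have h3 : |(R.TZ a).T (R.inner a) V| ≤ K * wZ := by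
    have h := abs_apply_le_apply (R.TZ a) h2 V
    rw [(R.TZ a).smul K Bz V] at h
    exact h.trans (mul_le_mul_of_nonneg_left (hZB V) hK)
  show |R.χ a V * (R.TZ a).T (R.inner a) V| ≤ _
  rw [abs_mul, abs_of_nonneg (hχ V).1]
  calc R.χ a V * |(R.TZ a).T (R.inner a) V| ≤ 1 * (K * wZ) :=
        mul_le_mul (hχ V).2 h3 (abs_nonneg _) zero_le_one
    _ = Real.exp BA * Bc * (wZ * wY) := by rw [hKdef]; ring

/-- **Discharging `TZ_a[Π_X B_X] ≤ Π_X w(X)` from the component structure**: the `Z_k`-operation of the summand `a` is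
the composite `T_{X₁}∘⋯∘T_{X_n}` of per-component operations over a nodup enumeration `l a` of the components of `Z_k`
((2.19) [III]; [IV] p. 201: the history sum is per component; any order — *"The operations corresponding to disjoint
regions commute"*), each component operation weighs its own Boltzmann factor, `T_X[B_X] ≤ w(X)` uniformly (the
per-component leaf), and pulls out the factors of the other components (`hpull`, the localization law of §1).  Then
`TZ_a[Π_{X∈Z_k} B_X] ≤ Π_{X∈Z_k} w(X)` — `pi_prod_le`. [cite: Balaban1989LargeFieldII, p.378 before (1.71) and p.387 after (1.89)] -/
theorem tz_boltzmann_le_of_factors [DecidableEq Dom] (R : Repr172 Cfg Dom) (T : R.Adm → Dom → PosOp Cfg)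
    (l : R.Adm → List Dom) (hnd : ∀ a, (l a).Nodup) (hset : ∀ a, (l a).toFinset = R.Zc a)
    (hTZ : ∀ a F V, (R.TZ a).T F V = (PosOp.pi (T a) (l a)).T F V)
    (B : R.Adm → Dom → Cfg → ℝ) (w : Dom → ℝ)
    (hB : ∀ a, ∀ X ∈ R.Zc a, ∀ V, 0 ≤ B a X V)
    (hw : ∀ a, ∀ X ∈ R.Zc a, ∀ V, (T a X).T (B a X) V ≤ w X)
    (hpull : ∀ a, ∀ X ∈ R.Zc a, ∀ X' ∈ R.Zc a, X ≠ X' → Pull (T a X) (B a X')) :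
    ∀ a V, (R.TZ a).T (fun V => ∏ X ∈ R.Zc a, B a X V) V ≤ ∏ X ∈ R.Zc a, w X := by
  intro a V
  have hm : ∀ X, X ∈ l a → X ∈ R.Zc a := fun X hX => by
    rw [← hset a, List.mem_toFinset]
    exact hX
  rw [hTZ, ← hset a]
  exact pi_prod_le (T a) (B a) w (hnd a) (fun X hX => hB a X (hm X hX)) (fun X hX => hw a X (hm X hX))
    (fun X hX X' hX' hne => hpull a X (hm X hX) X' (hm X' hX') hne) V

/-- **The per-component leaf in the improved-(1.89) shape is what `B16Improved189` delivers** (composed BY NAME): for the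
weight function `V ↦ T_X[B_X](V)` of one component, the fundamental inequality (1.89) `≤ exp(−2(1+β₀)⁻¹p₀(g_k))`
(`Step.FundIneq189`) and the size trade `κ₁d_k(X) ≤ (1+β₀)⁻¹p₀(g_k)` give `T_X[B_X] ≤ exp(−(1+β₀)⁻¹p₀(g_k) − κ₁d_k(X))`
— the hypothesis `hw` of `uvIneq_of_repr172_wilson` with `c₀ = (1+β₀)⁻¹p₀(g_k)` (half the printed budget, unit adv3's
reading, cell GAPS G-adv3-6). [cite: Balaban1989LargeFieldII, (1.89) p.387] -/
theorem hw_of_improved189 (T : PosOp Cfg) (B : Cfg → ℝ) (A₀ : ℝ) (p₀ : ℕ) (β₀ gk κ₁ dX : ℝ)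
    (h189 : Step.FundIneq189 (fun V => T.T B V) A₀ p₀ β₀ gk)
    (htrade : κ₁ * dX ≤ (1 + β₀)⁻¹ * p0Profile A₀ p₀ gk) :
    ∀ V, T.T B V ≤ Real.exp (-((1 + β₀)⁻¹ * p0Profile A₀ p₀ gk) - κ₁ * dX) :=
  B16Improved189.improved189_of_fundIneq (fun V => T.T B V) A₀ p₀ β₀ gk κ₁ dX h189 htrade

/-- **(2.50)/(0.1), one run, one step, from (1.72) + (1.73) — Wilson form**: gen 4's `Repr172.uvIneq_of_repr172` with the
two factor leaves `hZ : TZ_a 1 ≤ Π_{X∈Z_k} e^{−c₀−κ₁d_k(X)}` and `hA′up : A′_k ≤ E′N` REPLACED by the printed mechanism: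
`hTZ` (the `Z_k`-operation is the composite of its component operations, (2.19) [III] / p. 378 / [IV] p. 201), `hpull`
(the component operations pull out the Boltzmann factors of the other components — localization), `hw` (per component:
the operation weighs its own Boltzmann factor by `exp(−c₀ − κ₁d_k(X))` — (1.79)/(1.89)-improved *"for the 𝐓-operation
connected with an arbitrary large field region"*, p. 387, the factor coming from the Wilson action, [III] p. 264, [V]
p. 380; `hw_of_improved189`), `hsplit` (`exp A′_k ≤ e^{E′N}·Π_{X∈Z_k} B_X` — §2 `exp_split_of_wilson` from (2.23)/(2.49)).
All other hypotheses — (1.72) holds for the density (`hH`), characteristic functions in `[0,1]` and the all-small one `=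
χ_k`, `hY` ((1.89)-improved per `Y_i`, composed), `hcurly`, `h0c`, `hR`, the lower (2.49) bookkeeping `hA'`, the cube
count `hπ`, the tree-decay data — and the conclusion `B16.UVIneq` with `E₋ = E₁ + ε`, `E₊ = E′ + ε′ + πc·K₀(c₀,Δ)·Σ_{i<2}
e^{−c_i}` are those of gen 4 verbatim; the assembly is `B16Cor3Scales.uvIneq_of_structure_classes` with two classes. [cite: Balaban1989LargeFieldII, (0.1) p.356 and p.387 after (1.89)] -/
theorem uvIneq_of_repr172_wilson (D : B16.RunData) (k : ℕ) (S : LocDomainSys) [DecidableEq S.Dom]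
    (R : Repr172 (D.Cfg k) S.Dom)
    (G : B12TreeDecay.CubeSystem S) {Δ : ℕ} (hΔ : G.DegreeLE Δ) {c₀ : ℝ}
    (hV : G.VolumeLeaf c₀) {κ₁ : ℝ} (hκ : B12TreeDecay.kappa₀ c₀ Δ ≤ κ₁)
    (c : Fin 2 → ℝ) (πc : ℝ) (hπ : (Fintype.card G.toCubeCover.Cube : ℝ) ≤ πc * (D.numSites k : ℝ))
    (Rre : D.Cfg k → ℝ) (E₁ ε ε' E' : ℝ)
    (hH : R.Holds (D.ρ k))
    (hχ01 : ∀ a V, 0 ≤ R.χ a V ∧ R.χ a V ≤ 1)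
    (h0χ : ∀ V, R.χ R.allSmall V = D.χ k V)
    (T : R.Adm → S.Dom → PosOp (D.Cfg k)) (l : R.Adm → List S.Dom)
    (hnd : ∀ a, (l a).Nodup) (hset : ∀ a, (l a).toFinset = R.Zc a)
    (hTZ : ∀ a F V, (R.TZ a).T F V = (PosOp.pi (T a) (l a)).T F V)
    (B : R.Adm → S.Dom → D.Cfg k → ℝ)
    (hB : ∀ a, ∀ X ∈ R.Zc a, ∀ V, 0 ≤ B a X V)
    (hpull : ∀ a, ∀ X ∈ R.Zc a, ∀ X' ∈ R.Zc a, X ≠ X' → Pull (T a X) (B a X'))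
    (hw : ∀ a, ∀ X ∈ R.Zc a, ∀ V, (T a X).T (B a X) V ≤ Real.exp (-(c 0) - κ₁ * S.dj X))
    (hsplit : ∀ a V, Real.exp (R.A' V) ≤ Real.exp (E' * (D.numSites k : ℝ)) * ∏ X ∈ R.Zc a, B a X V)
    (hY : ∀ a V, (R.TYs a).T 1 V ≤ ∏ Y ∈ R.Ys a, Real.exp (-(c 1) - κ₁ * S.dj Y))
    (hcurly : ∀ a V, 0 ≤ R.curly a V ∧ R.curly a V ≤ Real.exp (ε' * (D.numSites k : ℝ)))
    (h0c : ∀ V, R.curly R.allSmall V = Real.exp (Rre V))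
    (hR : ∀ V, |Rre V| ≤ ε * (D.numSites k : ℝ))
    (hA' : ∀ V, D.χ k V ≠ 0 →
      -(1 / (D.flow.g k) ^ 2 * D.wilsonBG k V) - E₁ * (D.numSites k : ℝ) ≤ R.A' V) :
    ∀ V : D.Cfg k, B16.UVIneq D k V (E₁ + ε)
      (E' + ε' + πc * B12TreeDecay.K₀ c₀ Δ * ∑ i, Real.exp (-(c i))) := by
  set N : ℝ := (D.numSites k : ℝ) with hN
  let W : Fin 2 × S.Dom → ℝ := fun t => Real.exp (-(c t.1) - κ₁ * S.dj t.2)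
  let major : R.Adm → ℝ := fun a => Real.exp ((E' + ε') * N) * ∏ t ∈ R.fam a, W t
  have habs : ∀ a V, |R.curly a V| ≤ Real.exp (ε' * N) := fun a V => by
    rw [abs_of_nonneg (hcurly a V).1]
    exact (hcurly a V).2
  have hZB : ∀ a V, (R.TZ a).T (fun V => ∏ X ∈ R.Zc a, B a X V) V ≤ ∏ X ∈ R.Zc a, W (0, X) :=
    tz_boltzmann_le_of_factors R T l hnd hset hTZ B (fun X => W (0, X)) hB hw hpull
  have hBz : ∀ a V, 0 ≤ ∏ X ∈ R.Zc a, B a X V := fun a V => Finset.prod_nonneg fun X hX => hB a X hX V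
  have hU1 : ∀ a V, R.term a V ≤ major a := fun a V => by
    have h := abs_term_le_boltzmann R a (fun V => ∏ X ∈ R.Zc a, B a X V) (hχ01 a) (hBz a) (hsplit a)
      (hZB a) (hY a) (habs a) V
    refine (le_abs_self _).trans (h.trans (le_of_eq ?_))
    show _ = Real.exp ((E' + ε') * N) * ∏ t ∈ R.fam a, W t
    rw [R.prod_fam W a, ← Real.exp_add, show E' * N + ε' * N = (E' + ε') * N by ring]
  have hL1 : ∀ a V, 0 ≤ R.term a V := fun a V =>
    R.term_nonneg a (fun V => (hχ01 a V).1) (fun V => (hcurly a V).1) V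
  have hχ : ∀ V, 0 ≤ D.χ k V := fun V => by
    rw [← h0χ V]
    exact (hχ01 R.allSmall V).1
  exact B16Cor3Scales.uvIneq_of_structure_classes D k (R.toTermData major) S G hΔ hV hκ c πc hπ R.fam R.A' Rre
    E₁ ε (E' + ε') (R.termData_holds major hH) hU1 R.fam_injective (fun a => le_rfl) hL1
    (R.form_allSmall Rre h0χ h0c) hχ hA' hR

/-- **(2.50)/(0.1), one run, one step — the exponential split made explicit**: `uvIneq_of_repr172_wilson` with the
Boltzmann factors INSTANTIATED as `B_X = exp(−Σ_{p∈plaq X} e_p)` and `hsplit` DISCHARGED by `exp_split_of_wilson` (§2):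
the remaining leaves are the Wilson decomposition `A′_k = rest − Σ_{p∈P} e_p`, `e_p ≥ 0` ((2.23) [III], (1.70)), the
attribution of disjoint plaquette families to the components of `Z_k`, the upper bookkeeping `rest ≤ E′N` ((2.49)
[III], cell GAPS G-adv3-2), the component structure and the localization law, and the per-component Gaussian bound
`T_X[exp(−Σ_{p∈plaq X} e_p)] ≤ exp(−c₀ − κ₁d_k(X))` — [V] p. 380 *"we bound the Wilson action and the quadratic forms, or
rather the corresponding Gaussian integrals. We have to obtain all small factors connected with large fields … using
Theorem 1 [15] and (71) [16]"*, in the (1.89)-improved form of p. 387. [cite: Balaban1989LargeFieldII, p.380 after (1.73) and p.387 after (1.89)] -/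
theorem uvIneq_of_repr172_wilsonSplit (D : B16.RunData) (k : ℕ) (S : LocDomainSys) [DecidableEq S.Dom]
    (R : Repr172 (D.Cfg k) S.Dom)
    (G : B12TreeDecay.CubeSystem S) {Δ : ℕ} (hΔ : G.DegreeLE Δ) {c₀ : ℝ}
    (hV : G.VolumeLeaf c₀) {κ₁ : ℝ} (hκ : B12TreeDecay.kappa₀ c₀ Δ ≤ κ₁)
    (c : Fin 2 → ℝ) (πc : ℝ) (hπ : (Fintype.card G.toCubeCover.Cube : ℝ) ≤ πc * (D.numSites k : ℝ))
    (Rre : D.Cfg k → ℝ) (E₁ ε ε' E' : ℝ)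
    (hH : R.Holds (D.ρ k))
    (hχ01 : ∀ a V, 0 ≤ R.χ a V ∧ R.χ a V ≤ 1)
    (h0χ : ∀ V, R.χ R.allSmall V = D.χ k V)
    (T : R.Adm → S.Dom → PosOp (D.Cfg k)) (l : R.Adm → List S.Dom)
    (hnd : ∀ a, (l a).Nodup) (hset : ∀ a, (l a).toFinset = R.Zc a)
    (hTZ : ∀ a F V, (R.TZ a).T F V = (PosOp.pi (T a) (l a)).T F V)
    {Pl : Type*} [DecidableEq Pl] (rest : D.Cfg k → ℝ) (P : Finset Pl) (e : Pl → D.Cfg k → ℝ)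
    (he : ∀ p ∈ P, ∀ V, 0 ≤ e p V) (hA : ∀ V, R.A' V = rest V - ∑ p ∈ P, e p V)
    (plaq : R.Adm → S.Dom → Finset Pl) (hsub : ∀ a, ∀ X ∈ R.Zc a, plaq a X ⊆ P)
    (hdisj : ∀ a, (R.Zc a : Set S.Dom).PairwiseDisjoint (plaq a))
    (hrest : ∀ V, rest V ≤ E' * (D.numSites k : ℝ))
    (hpull : ∀ a, ∀ X ∈ R.Zc a, ∀ X' ∈ R.Zc a, X ≠ X' →
      Pull (T a X) (fun V => Real.exp (-(∑ p ∈ plaq a X', e p V))))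
    (hw : ∀ a, ∀ X ∈ R.Zc a, ∀ V,
      (T a X).T (fun V => Real.exp (-(∑ p ∈ plaq a X, e p V))) V ≤ Real.exp (-(c 0) - κ₁ * S.dj X))
    (hY : ∀ a V, (R.TYs a).T 1 V ≤ ∏ Y ∈ R.Ys a, Real.exp (-(c 1) - κ₁ * S.dj Y))
    (hcurly : ∀ a V, 0 ≤ R.curly a V ∧ R.curly a V ≤ Real.exp (ε' * (D.numSites k : ℝ)))
    (h0c : ∀ V, R.curly R.allSmall V = Real.exp (Rre V))
    (hR : ∀ V, |Rre V| ≤ ε * (D.numSites k : ℝ))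
    (hA' : ∀ V, D.χ k V ≠ 0 →
      -(1 / (D.flow.g k) ^ 2 * D.wilsonBG k V) - E₁ * (D.numSites k : ℝ) ≤ R.A' V) :
    ∀ V : D.Cfg k, B16.UVIneq D k V (E₁ + ε)
      (E' + ε' + πc * B12TreeDecay.K₀ c₀ Δ * ∑ i, Real.exp (-(c i))) :=
  uvIneq_of_repr172_wilson D k S R G hΔ hV hκ c πc hπ Rre E₁ ε ε' E' hH hχ01 h0χ T l hnd hset hTZ
    (fun a X V => Real.exp (-(∑ p ∈ plaq a X, e p V))) (fun _ _ _ _ => (Real.exp_pos _).le) hpull hw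
    (fun a V => exp_split_of_wilson R.A' rest P e he hA (R.Zc a) (plaq a) (hsub a) (hdisj a) hrest V)
    hY hcurly h0c hR hA'

/-- **Gen 4's leaf is the case `B ≡ 1`**: if the Boltzmann factors are trivial (the operation read as INCLUDING the
exponential of its region — the reading under which `hZ` of `uvIneq_of_repr172` is the printed mechanism, cell DIVERGENCE
D-pv06.5), the pull-out law holds automatically (`pull_const`), the split is `A′_k ≤ E′N` (`hA′up`), and the component
structure gives back `TZ_a 1 ≤ Π_{X∈Z_k} w(X)` from the per-component weights `T_X 1 ≤ w(X)` — gen 4's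
`PosOp.pi_one_le_prod`. [cite: Balaban1989LargeFieldII, p.387 after (1.89)] -/
theorem tz_one_le_of_factors [DecidableEq Dom] (R : Repr172 Cfg Dom) (T : R.Adm → Dom → PosOp Cfg)
    (l : R.Adm → List Dom) (hnd : ∀ a, (l a).Nodup) (hset : ∀ a, (l a).toFinset = R.Zc a)
    (hTZ : ∀ a F V, (R.TZ a).T F V = (PosOp.pi (T a) (l a)).T F V) (w : Dom → ℝ)
    (hw : ∀ a X V, (T a X).T 1 V ≤ w X) :
    ∀ a V, (R.TZ a).T 1 V ≤ ∏ X ∈ R.Zc a, w X := by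
  intro a V
  rw [hTZ, ← hset a]
  exact PosOp.pi_one_le_prod (T a) w (hw a) (hnd a) V

end Terms

/-! ## 4. Where the pull-out law comes from: determining sets and integration sets ((2.10)–(2.16) [III])

[III] p. 256 [14]: *"The fields V_j determine the field V defined on 𝐁: V = V_j on Γ_j, j = 0,1,…,k. (2.10)"*; *"A
regular configuration V on 𝐁 determines the minimal orbit, i.e., the set of minima, of the functional U → A^η(U) on U :
U regular and M_𝐁(U) = V. (2.12) … A minimal configuration, i.e., an element of the unique minimal orbit, is denoted
by U_𝐁(V), or U_k(V), or simply U_k"* — the background field of the Wilson action in (2.18)/(2.23) is the GLOBAL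
constrained minimizer, a non-local function of all the variables `V`; *"In constructions of this and subsequent
sections and papers we will have to localize gauge field configurations, especially solutions of the variational
problems, so it is convenient to describe some standard constructions …"*; p. 257 [15]: *"If we are given a determining
set 𝐁, and the corresponding function U_𝐁, then it is frequently necessary to localize them to a domain Ω."*,
(2.14)–(2.15) `𝐁∪𝐁_j(Ω)`, `U(𝐁∪𝐁_j(Ω), ·) = U_{𝐁,Ω}(·)`, (2.16) *"U_{k,□}(V_k) = U(𝐁_k(□^{~4}), M^·(Q_k^{s*}V_k))"*.  In the
kernel model of the operations (gen 4's `PosOp.ofKernel`, configurations = one variable per site/bond, `x : Π s, Val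
s`) the pull-out law `hpull` of §3 is EXACTLY a disjointness statement: the factor depends only on the variables of a
DETERMINING SET (Mathlib's `DependsOn`), the operation modifies only the variables of an INTEGRATION SET ([III] p. 258:
*"integration with respect to the gauge field variables V_j on Ω^c_{j+1} ∩ X, and … A_j on Z_{j+1} ∩ Ω_{j+1} ∩ X"*),
and the two sets are disjoint.  So `hpull` holds as soon as the Wilson terms attributed to a component `X′` of `Z_k` are
written with a field LOCALIZED in the sense of (2.14)–(2.16) — determined by variables in a neighbourhood `Dset X′` of
`X′` disjoint from the integration sets of the other components — a DATUM (`hsep` of `hpull_of_disjoint` below): print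
states that the components of `Z` are disjoint ([IV] p. 177 [3]: *"Thus we write the factorization property (2.19) [III],
𝐓_k(Z_k) = 𝐓_k(Z_k ∩ Z^c)𝐓_k(Z) = 𝐓_k(Z_k ∩ Z^c) Π_{i=1}^m 𝐓_k(X_i), (1.1) where Z = ∪_{i=1}^m X_i is the decomposition
into disjoint components."*), whereas the [III] p. 256 [14] sentence cited by v2 at this place — *"The domains Ω_j, Λ_j,
… are unions of MR_j-cubes in the lattice T_{L^{−j}}. They satisfy also other conditions, e.g., the distance between their
boundaries is at least equal to 2MR_j, …"* — concerns the nested domains of successive steps, NOT two components of one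
region; no printed sentence separating the determining set of one component from the integration set of another has
been located (v3 DOCFIX, cell GAPS C-ref5-42 V1).  Whether (1.70)/(1.72) write `−A⌈_{Z_k}` with such localized fields
(and where the localization error goes) is the located residual, cell GAPS G-pv06-4; this section types its "Needed (a)"
and discharges `hpull` from it. -/

section DeterminingSets

variable {Site : Type*} {Val : Site → Type*}

/-- **Pull-out from disjointness of determining and integration sets.**  In the kernel model `(TF)(x) = Σ_ω K(x,ω)
F(φ_ω x)`: if every modification `φ_ω` changes the configuration only on the integration set `I` and `H` depends only on
the variables of a determining set `Dset` disjoint from `I`, then `T(F·H) = (TF)·H`. [cite: Balaban1988Convergent, (2.14)–(2.16) p.257] -/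
theorem pull_ofKernel_of_dependsOn {Ω : Type*} (S : Finset Ω) (K : (Π s, Val s) → Ω → ℝ)
    (φ : Ω → (Π s, Val s) → (Π s, Val s)) (hK : ∀ x ω, 0 ≤ K x ω) (I Dset : Set Site)
    (hφ : ∀ ω ∈ S, ∀ x, ∀ s, s ∉ I → φ ω x s = x s)
    {H : (Π s, Val s) → ℝ} (hH : DependsOn H Dset) (hdisj : Disjoint Dset I) :
    Pull (PosOp.ofKernel S K φ hK) H :=
  pull_ofKernel S K φ hK fun x ω hω =>
    hH fun s hs => hφ ω hω x s (Set.disjoint_left.mp hdisj hs)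

/-- A Boltzmann factor `exp(−Σ_{p∈P} e_p)` whose plaquette terms depend only on the variables of `Dset` (the Wilson
terms of a component written with the localized field `U_{k,X′}` of (2.16), determined by `𝐁_k(X′^{~4})`) depends only
on `Dset`. [cite: Balaban1988Convergent, (2.16) p.257] -/
theorem dependsOn_boltzmann {Pl : Type*} (P : Finset Pl) (e : Pl → (Π s, Val s) → ℝ) (Dset : Set Site)
    (he : ∀ p ∈ P, DependsOn (e p) Dset) :
    DependsOn (fun x => Real.exp (-(∑ p ∈ P, e p x))) Dset := by
  intro x y hxy
  have h : ∑ p ∈ P, e p x = ∑ p ∈ P, e p y := Finset.sum_congr rfl fun p hp => he p hp hxy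
  simp only [h]

/-- **The hypothesis `hpull` of `uvIneq_of_repr172_wilsonSplit` DISCHARGED from localization + separation** (one
summand; kernel-model component operations): if the operation of each component `X ∈ Z_k` modifies only the variables
of its integration set `I X`, the Wilson terms attributed to `X′` depend only on the variables of the determining set
`Dset X′` of its localized field ((2.14)–(2.16)), and `Dset X′ ∩ I X = ∅` for distinct components (`hsep`, a DATUM:
print gives the disjointness of the components, [IV] p. 177 (1.1), not this separation — no printed sentence located,
v3 DOCFIX C-ref5-42 V1), then the operation of `X` pulls out the Boltzmann factor of `X′`.  The
composite/history-sum structure of the genuine operations is covered by `pull_comp`, `pull_sumOp`, `pull_pi` of §1. [cite: Balaban1988Convergent, (2.16) p.257 and (2.19) p.258] -/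
theorem hpull_of_disjoint {Dom Ω Pl : Type*} (Zc : Finset Dom) (S : Dom → Finset Ω)
    (K : Dom → (Π s, Val s) → Ω → ℝ) (φ : Dom → Ω → (Π s, Val s) → (Π s, Val s))
    (hK : ∀ X x ω, 0 ≤ K X x ω) (I Dset : Dom → Set Site)
    (hφ : ∀ X ∈ Zc, ∀ ω ∈ S X, ∀ x, ∀ s, s ∉ I X → φ X ω x s = x s)
    (plaq : Dom → Finset Pl) (e : Pl → (Π s, Val s) → ℝ)
    (he : ∀ X ∈ Zc, ∀ p ∈ plaq X, DependsOn (e p) (Dset X))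
    (hsep : ∀ X ∈ Zc, ∀ X' ∈ Zc, X ≠ X' → Disjoint (Dset X') (I X)) :
    ∀ X ∈ Zc, ∀ X' ∈ Zc, X ≠ X' →
      Pull (PosOp.ofKernel (S X) (K X) (φ X) (hK X)) (fun x => Real.exp (-(∑ p ∈ plaq X', e p x))) :=
  fun X hX X' hX' hne =>
    pull_ofKernel_of_dependsOn (S X) (K X) (φ X) (hK X) (I X) (Dset X') (hφ X hX)
      (dependsOn_boltzmann (plaq X') e (Dset X') (he X' hX')) (hsep X hX X' hX' hne)

/-- Conversely the law FAILS without disjointness already for one variable: the operation "set the variable to `0` or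
to `1` with weights ½" applied to the factor `H(x) = x` itself gives `T(1·H) = ½ ≠ (T1)·H(x) = x` at `x = 0` — the
exact pull-out of a factor depending on an INTEGRATED variable (the un-localized `U_k(V)` on a plaquette of `X′`
depends on the variables integrated in `X`, [III] p. 256/p. 258) is false, which is why the localization of
(2.14)–(2.16) is needed (cell GAPS G-pv06-4). [folklore] -/
theorem pull_fails_without_disjointness :
    ¬ Pull (PosOp.ofKernel ({0, 1} : Finset ℝ) (fun (_ : Unit → ℝ) (_ : ℝ) => (1 / 2 : ℝ))
        (fun ω _ => fun _ => ω) (fun _ _ => by norm_num)) (fun x : Unit → ℝ => x ()) := by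
  intro h
  have h1 := h (fun _ => 1) (fun _ => 0)
  change ∑ ω ∈ ({0, 1} : Finset ℝ), (1 / 2 : ℝ) * ((fun _ : Unit → ℝ => (1 : ℝ)) (fun _ => ω) * (fun _ : Unit => ω) ())
    = (∑ ω ∈ ({0, 1} : Finset ℝ), (1 / 2 : ℝ) * (fun _ : Unit → ℝ => (1 : ℝ)) (fun _ => ω)) * (fun _ : Unit => (0 : ℝ)) () at h1
  norm_num at h1

end DeterminingSets

end Literature.MathematicalPhysics.QuantumFieldTheory.Balaban1983to89.B16Cor3Wilson
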